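import Summits.CriticalPhenomena.PercolationContinuityZ3.Theorems.Transplant.FKConnectivityAllQClusterDomCex
import Summits.CriticalPhenomena.PercolationContinuityZ3.Theorems.Transplant.FKConnectivityAllQCountReweightedClusterDomDefs
import Summits.CriticalPhenomena.PercolationContinuityZ3.Theorems.Transplant.FKConnectivityAllQCondClusterDomDefs
import Summits.CriticalPhenomena.PercolationContinuityZ3.Theorems.Transplant.FKConnectivityAllQEmbedding
import HarnessLib

/-!
# MMc⁺ and MM-for-log-convex-count-weights are FALSE: `¬ CondClusterDomAdjFKPos`, `¬ ClusterDomAdjLogConvexPos` — corollaries of the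
# `K_{1,1,4}` refutation of MM, through a transport lemma (MMc⁺ on `U` gives MM on every `V ↪ U` with an idle vertex to condition on)

Support file (`--supports stmt-CriticalPhenomena-4575`), FK sub-lane `prim-bschramm-fk-1` (gen 11) of the post-continuity programme;
builds on p205010 (kernel theorem, internal audit signed; external expert review pending).  No definitions, no named facts, no sorries;
standard axioms.  Nothing here bears on p205010: the refuted nodes are research conjectures of this sub-lane about `φ_{w,q}` for `q < 1`.

CONTEXT.  The census seat `prim-bschramm-census` (gen 20) found and certified (`…ClusterDomCex`, `not_clusterDomAdjOn_fin_six`,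
`not_clusterDomAdjFKPos`; lane INBOX 2026-08-21T10:18Z; confirmed independently by this seat with exact rational arithmetic) that MM —
stochastic monotonicity of the cluster `C_x` in an adjacent edge `f = xz` — FAILS for `φ_{w,q}` at small `q`: `G = K_{1,1,4}` (hubs `4,5`, leaves
`0..3`), `x = 5`, `f = 45`, `𝒰 = {S ⊇ leaves}`, `q = 1/1000`, `p = 1/11`: `φ_{w[f↦1]}(C_x ∈ 𝒰) − φ_{w[f↦0]}(C_x ∈ 𝒰) = −4.44·10⁻⁵`
(forest limit: given `f ∈ F` each leaf hangs on at most one hub, `(2λ/(1+2λ))⁴`; given `f ∉ F` one leaf may bridge the hubs,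
`(λ⁴+32λ⁵)/((1+2λ)³(1+2λ+4λ²))`; the second is larger iff `λ > 15/2`).  This file records the two consequences for THIS sub-lane's other nodes:
* **`not_clusterDomAdjLogConvexPos`** — fk-1 g10's `ClusterDomAdjLogConvexPos` (MM under `P_w·h(k)` for every positive log-convex `h`) contains
  MM for `h = q^k` (`clusterDomAdjFKPos_of_logConvexPos`), so it is false; the acyclic-support theorem `mm_count_of_forest_support` (on forests
  MM_h ⟺ h log-convex) is unaffected — `K_{1,1,4}` has cycles;
* **`not_condClusterDomAdjFKPos`** — fk-1 g8's MMc⁺ (`CondClusterDomAdjOn`: the law of `C_x` GIVEN `{x ↮ c}` is stochastically increasing in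
  the state of `f`) contains MM: condition on an IDLE vertex.  Formally, **`clusterDomAdjOn_of_condClusterDomAdjOn`**: for an injection
  `j : V ↪ U` of finite vertex types and a vertex `c ∉ range j`, `CondClusterDomAdjOn U q → ClusterDomAdjOn V q` (`0 < q`) — pad the weight
  vector by `0` along `Sym2.map j` (`Function.extend`), note that `{j x ↮ c}` is a sure event for image configurations and that the cluster of
  `j x` pulls back to the cluster of `x` (`reachable_image_iff`), and move the four measures with the fk-continuity cell's transport
  `rcMeasureW_real_image` (Grimmett 2006 (1.20) / Lemma (4.13): idle vertices do not matter).  Hence `¬ CondClusterDomAdjOn (Fin 7) (1/1000)`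
  and `¬ CondClusterDomAdjFKPos`.  (An exhaustive search of this seat finds NO violation of MMc⁺ on `K_{1,1,4}` itself with a NON-idle
  conditioning vertex `c ∈ {0,…,4}` and principal-type up-sets at `(q,p) ∈ {(1/512,1/32),(1/1024,1/64),(1/1000,1/11),(1/4096,1/128)}` — the
  idle vertex is the cheapest witness, not the only conceivable one.)
NOT affected (census-g20, same day): `ClusterAssocFKPos`, `HubFKPos` (ALR (13)), `ArborealHubPos` (ALR Conj. 7.1), `EdgeNegCorrAdjFKLtOne`,
and the `q = 1` case of MMc⁺ (vdBHK Thm 1.3); `CrossClusterAntiAdjFKPos` (MMc⁻) is untouched by this witness.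
(refuted-substantive for both nodes as filed; no cheap repair: the 'bridging leaf' mechanism is generic — every `K_{1,1,m}`, `m ≥ 4`.)
[cite: Grimmett2006, §1.4 eq. (1.20) (p. 15); §3.9 (pp. 63–65); Lemma (4.13) (p. 71)] [cite: VandenbergHaggstromKahn2005, Thm. 1.3 (p. 6)]
[cite: AyyerLinussonRavichandran2025, §7 Conj. 7.1 (p. 22)]
-/

noncomputable section

namespace Summit.CriticalPhenomena.PercolationContinuityZ3.Theorems

namespace FK

open MeasureTheory Set Literature.Probability.LatticeModels Literature.Probability.Percolation
open scoped Classical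

/-! ### Transport: MMc⁺ on `U` gives MM on every `V ↪ U` with an idle vertex to condition on -/

section Transport

variable {V U : Type*} [Fintype V] [Fintype U] (j : V ↪ U)

omit [Fintype V] [Fintype U] in
/-- Zero-padding of a weight vector along `Sym2.map j`, evaluated on the range. [folklore] -/
theorem extend_sym2Map_apply (w : Sym2 V → unitInterval) (e : Sym2 V) :
    Function.extend (Sym2.map j) w 0 (Sym2.map j e) = w e :=
  (Sym2.map.injective j.injective).extend_apply w 0 e

omit [Fintype V] [Fintype U] in
/-- Zero-padding of a weight vector along `Sym2.map j` vanishes off the range. [folklore] -/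
theorem extend_sym2Map_eq_zero (w : Sym2 V → unitInterval) {e : Sym2 U} (he : e ∉ Set.range (Sym2.map j)) :
    Function.extend (Sym2.map j) w 0 e = 0 := by
  rw [Function.extend_apply' _ _ _ (fun ⟨a, ha⟩ => he ⟨a, ha⟩)]
  rfl

omit [Fintype V] [Fintype U] in
/-- Updating the padded vector at an image pair is padding the updated vector. [folklore] -/
theorem update_extend_sym2Map (w : Sym2 V → unitInterval) (x z : V) (b : unitInterval) :
    Function.update (Function.extend (Sym2.map j) w 0) s(j x, j z) b =
      Function.extend (Sym2.map j) (Function.update w s(x, z) b) 0 := by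
  funext e
  by_cases he : e ∈ Set.range (Sym2.map j)
  · obtain ⟨e₀, rfl⟩ := he
    rw [extend_sym2Map_apply]
    by_cases h0 : e₀ = s(x, z)
    · subst h0
      rw [Function.update_self, Sym2.map_mk, Function.update_self]
    · have hne : Sym2.map j e₀ ≠ s(j x, j z) := fun h =>
        h0 (Sym2.map.injective j.injective (h.trans (Sym2.map_mk j x z).symm))
      rw [Function.update_of_ne hne, Function.update_of_ne h0, extend_sym2Map_apply]
  · have hne : e ≠ s(j x, j z) := fun h => he ⟨s(x, z), by rw [h, Sym2.map_mk]⟩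
    rw [Function.update_of_ne hne, extend_sym2Map_eq_zero j _ he, extend_sym2Map_eq_zero j _ he]

omit [Fintype V] [Fintype U] in
/-- The open cluster of `j x` in the image configuration pulls back to the open cluster of `x`. [cite: Grimmett2006, §4.3 (automorphism invariance)] -/
theorem preimage_openCluster_image (ω : BondConfig V) (x : V) :
    j ⁻¹' openCluster (Sym2.map j '' ω) (j x) = openCluster ω x := by
  ext y
  exact reachable_image_iff j ω x y

omit [Fintype V] [Fintype U] in
/-- A vertex outside the range of `j` is never joined to `j x` in an image configuration. [cite: Grimmett2006, §4.3 (automorphism invariance)] -/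
theorem image_mem_sepEv_of_not_mem_range (ω : BondConfig V) (x : V) {c : U} (hc : c ∉ Set.range j) :
    Sym2.map j '' ω ∈ (sepEv (j x) c : Set (BondConfig U)) := by
  rw [mem_sepEv_iff]
  intro h
  have hG : openGraph (Sym2.map j '' ω) = (openGraph ω).map j := by
    unfold openGraph
    exact fromEdgeSet_image_eq_map j ω
  rw [hG] at h
  obtain ⟨y, hy, -⟩ := exists_of_reachable_map j (openGraph ω) h
  exact hc ⟨y, hy.symm⟩

/-- **MMc⁺ on `U` implies MM on every smaller vertex type**: if `V` embeds in `U` leaving a vertex `c` outside the range, then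
`CondClusterDomAdjOn U q → ClusterDomAdjOn V q` (`0 < q`): pad `w` by zero, condition on the sure event `{j x ↮ c}`, and pull the four
measures back along `j` (transport `rcMeasureW_real_image`). [cite: Grimmett2006, §1.4 eq. (1.20) (p. 15); Lemma (4.13) (p. 71)] -/
theorem clusterDomAdjOn_of_condClusterDomAdjOn {q : ℝ} (hq : 0 < q) {c : U} (hc : c ∉ Set.range j)
    (h : CondClusterDomAdjOn U q) : ClusterDomAdjOn V q := by
  intro w x z 𝒰 h𝒰
  set w' : Sym2 U → unitInterval := Function.extend (Sym2.map j) w 0 with hw'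
  let 𝒰' : Set (Set U) := {S | j ⁻¹' S ∈ 𝒰}
  have h𝒰' : IsUpperSet 𝒰' := fun S T hST hS => h𝒰 (Set.preimage_mono hST) hS
  have key := h w' (j x) (j z) c 𝒰' h𝒰'
  have hvan : ∀ (b : unitInterval) (e : Sym2 U), e ∉ Set.range (Sym2.map j) →
      Function.update w' s(j x, j z) b e = 0 := by
    intro b e he
    rw [hw', update_extend_sym2Map, extend_sym2Map_eq_zero j _ he]
  have hcomp : ∀ b : unitInterval, (fun e => Function.update w' s(j x, j z) b (Sym2.map j e)) = Function.update w s(x, z) b := by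
    intro b
    funext e
    rw [hw', update_extend_sym2Map, extend_sym2Map_apply]
  have hmem : ∀ ω : BondConfig V, Sym2.map j '' ω ∈ clusterIn (j x) 𝒰' ↔ ω ∈ clusterIn x 𝒰 := fun ω => by
    change j ⁻¹' openCluster (Sym2.map j '' ω) (j x) ∈ 𝒰 ↔ openCluster ω x ∈ 𝒰
    rw [preimage_openCluster_image]
  have hev1 : {ω : BondConfig V | Sym2.map j '' ω ∈ clusterIn (j x) 𝒰' ∩ (sepEv (j x) c : Set (BondConfig U))} = clusterIn x 𝒰 := by
    ext ω
    rw [mem_setOf_eq, mem_inter_iff, hmem]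
    exact ⟨fun h => h.1, fun h => ⟨h, image_mem_sepEv_of_not_mem_range j ω x hc⟩⟩
  have hev2 : {ω : BondConfig V | Sym2.map j '' ω ∈ (sepEv (j x) c : Set (BondConfig U))} = univ :=
    Set.eq_univ_of_forall fun ω => image_mem_sepEv_of_not_mem_range j ω x hc
  have hprob : ∀ b : unitInterval, (rcMeasureW (Function.update w s(x, z) b) q ∅).real (univ : Set (BondConfig V)) = 1 := by
    intro b
    haveI := isProbabilityMeasure_rcMeasureW (Function.update w s(x, z) b) hq ∅
    exact probReal_univ
  rw [rcMeasureW_real_image j _ (hvan 0) hq, rcMeasureW_real_image j _ (hvan 1) hq, rcMeasureW_real_image j _ (hvan 1) hq,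
    rcMeasureW_real_image j _ (hvan 0) hq, hcomp 0, hcomp 1, hev1, hev2, hprob 0, hprob 1, mul_one, mul_one] at key
  exact key

/-- `Fin n ↪ Fin (n+1)` misses the last vertex, so MMc⁺ on `Fin (n+1)` gives MM on `Fin n`. [cite: Grimmett2006, Lemma (4.13) (p. 71)] -/
theorem clusterDomAdjOn_fin_of_condClusterDomAdjOn_succ {q : ℝ} (hq : 0 < q) (n : ℕ)
    (h : CondClusterDomAdjOn (Fin (n + 1)) q) : ClusterDomAdjOn (Fin n) q :=
  clusterDomAdjOn_of_condClusterDomAdjOn Fin.castSuccEmb hq (c := Fin.last n)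
    (by rintro ⟨y, hy⟩; exact (Fin.castSucc_lt_last y).ne hy) h

end Transport

/-! ### Consequences of the `K_{1,1,4}` refutation of MM -/

/-- **MM for log-convex count weights is false: `¬ ClusterDomAdjLogConvexPos`** (`q^k` with `0 < q` is positive and log-convex, and MM fails
for `φ_{w,1/1000}` on `K_{1,1,4}` — census-g20's `not_clusterDomAdjFKPos`).  The acyclic-support theorem `mm_count_of_forest_support` is
unaffected. [cite: Grimmett2006, §3.9 (pp. 63–65)] -/
theorem not_clusterDomAdjLogConvexPos : ¬ ClusterDomAdjLogConvexPos := fun h =>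
  not_clusterDomAdjFKPos (clusterDomAdjFKPos_of_logConvexPos h)

/-- **MMc⁺ fails on `Fin 7` at `q = 1/1000`** (`K_{1,1,4}` plus an idle seventh vertex to condition on; census-g20's `Fin 6` witness
transported by `clusterDomAdjOn_fin_of_condClusterDomAdjOn_succ`). [cite: Grimmett2006, §1.4 eq. (1.20) (p. 15); Lemma (4.13) (p. 71)] -/
theorem not_condClusterDomAdjOn_fin_seven : ¬ CondClusterDomAdjOn (Fin 7) ((1 / 1000 : ℚ) : ℝ) := fun h =>
  not_clusterDomAdjOn_fin_six (clusterDomAdjOn_fin_of_condClusterDomAdjOn_succ (by norm_num) 6 h)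

/-- **MMc⁺ is false: `¬ CondClusterDomAdjFKPos`** (fk-1 g8's conditional cluster-dominance node contains MM: condition on an idle vertex).
Its `q = 1` case (one-cluster conditional association, vdBHK Thm 1.3) is untouched. [cite: VandenbergHaggstromKahn2005, Thm. 1.3 (p. 6)]
[cite: Grimmett2006, §3.9 (pp. 63–65)] -/
theorem not_condClusterDomAdjFKPos : ¬ CondClusterDomAdjFKPos := fun h =>
  not_condClusterDomAdjOn_fin_seven (h ((1 / 1000 : ℚ) : ℝ) (by norm_num) 7)

end FK

end Summit.CriticalPhenomena.PercolationContinuityZ3.Theorems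

end
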